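import Summits.ResolutionOfSingularities.ResolutionOfSingularities.Theorems.FrobeniusLadderFInjectiveMacaulayficationFedderOrigin
import Summits.ResolutionOfSingularities.ResolutionOfSingularities.Theorems.FrobeniusLadderFInjectiveMacaulayficationHypersurfaceRegular
import Summits.ResolutionOfSingularities.ResolutionOfSingularities.Theorems.FrobeniusLadderFInjectiveMacaulayficationFiClauseOfRegular
import Summits.ResolutionOfSingularities.ResolutionOfSingularities.Theorems.FrobeniusLadderFInjectiveMacaulayficationQuotLocalizationIso
import Summits.ResolutionOfSingularities.ResolutionOfSingularities.Theorems.FrobeniusLadderFInjectiveMacaulayficationDegreeZeroDescentLocal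
import Mathlib.Algebra.MvPolynomial.Rename
import Mathlib.Algebra.MvPolynomial.PDeriv
import Mathlib.Algebra.CharP.Algebra
import HarnessLib

/-!
# The `y`-chart of `Bl_𝔪(E₈⁰)` in characteristic 5 satisfies the clause along the exceptional divisor

Support file for crux stmt-ResolutionOfSingularities-15315
(`FrobeniusLadder.FInjectiveMacaulayfication`, line `Sketch`, lead seat c4, cycle 5, wave 3):
stub `stub_e8ChartYPoints` of the §7 CALIBRATION package (the blowing up `Bl_𝔪 E₈⁰` of the
rational double point `E₈⁰ : z² + x³ + y⁵ = 0` in characteristic `5`, fed through the blow-up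
glue E6′).

Let `k` be a field of characteristic `5` and `S = k[X₀, X₁, X₂]`. The `y`-chart of the point
blow-up of `E₈⁰` is the hypersurface `S/(g_y)`, `g_y = X₂² + X₁X₀³ + X₁³` (upstairs coordinates
`X 0 = x/y`, `X 1 = y` — the equation of the exceptional divisor `E` — and `X 2 = z/y`). We prove
(`stub_e8ChartYPoints`) that for EVERY maximal ideal `Q` of `S/(g_y)` on the exceptional divisor
(`X̄₁ ∈ Q`) the local ring `(S/(g_y))_Q` satisfies the per-stalk clause of the crux: every system of
parameters is a weakly regular sequence and generates a Frobenius closed ideal (Cohen–Macaulay +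
F-injective, inline form, `p = 5`).

Proof. Put `P = Q ∩ S` (a prime containing `X₁` and `g_y`).
* If `X₀ ∈ P` (`clause_of_comap_eq_origin`), then `X₂² = g_y - X₁(X₀³ + X₁²) ∈ P`, so `X₂ ∈ P` and
  `P = (X₀, X₁, X₂)` is the origin (`eq_span_range_X_of_mem`) — the `E₇`-type point of the chart.
  Fedder's test at the origin (`Fedder.fedder_criterion_origin`, [Fedder1983] Prop. 1.7 / Thm. 1.12)
  reduces the clause for `S_P/(g_y)` to `g_y⁴ ∉ (X₀⁵, X₁⁵, X₂⁵)`, which is `E8Char5.e7_fedder_char5`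
  transported along the renaming automorphism `X₁ ↔ X₂` of `S` (`rename_swap_gy`,
  `gy_pow_four_notMem`: the automorphism maps `g_y` to `X₁² + X₂X₀³ + X₂³` and the monomial ideal
  `(Xᵢ⁵)` into itself). The clause then moves along `S_P/(g_y) ≅ (S/(g_y))_Q`
  (`QuotLocalizationIso.stub_quotLocalizationIso`, `DegreeZeroDescent.inlineClause_of_ringEquiv`).
* If `X₀ ∉ P` (`clause_of_X_zero_notMem`), then `∂g_y/∂X₁ = X₀³ + 3X₁² ∉ P` (`pderiv_one_gy`; `X₀³ ∉ P`
  by primality while `3X₁² ∈ P`), so `(S/(g_y))_Q` is a regular local ring by the Jacobian criterion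
  (`HypersurfaceRegular.stub_hypersurfaceRegularOfPderiv`, [Matsumura1987] Thm. 30.4) and the clause
  holds for regular local rings of characteristic `5` (`FiClauseOfRegular.stub_fiClauseOfRegular`);
  the characteristic passes to `S/(g_y)` (a non-trivial `k`-algebra) and to its localizations.

References: [Fedder1983] R. Fedder, F-purity and rational singularity, Trans. AMS 278 (1983),
Prop. 1.7 and Thm. 1.12; M. Artin, Coverings of the rational double points in characteristic `p`
(1977) for `Bl_𝔪 E₈⁰ → E₇` (folklore); [Matsumura1987] H. Matsumura, Commutative Ring Theory, Thm. 30.4.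
-/

-- single-problem summit: the doubled namespace component is forced
set_option linter.dupNamespace false

noncomputable section

namespace Summit.ResolutionOfSingularities.ResolutionOfSingularities.Theorems.FInjectiveMacaulayfication.E8ChartYPoints

open MvPolynomial
open Summit.ResolutionOfSingularities.ResolutionOfSingularities.Theorems.FInjectiveMacaulayfication

/-! ## Polynomial identities for `g_y = X₂² + X₁X₀³ + X₁³` -/

/-- **`∂g_y/∂X₁ = X₀³ + 3X₁²`** for `g_y = X₂² + X₁X₀³ + X₁³`, over any commutative ring
(`MvPolynomial.pderiv_mul`, `pderiv_pow`, `pderiv_X_self`, `pderiv_X_of_ne`). [folklore] -/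
theorem pderiv_one_gy {A : Type*} [CommRing A] :
    pderiv 1 (X 2 ^ 2 + X 1 * X 0 ^ 3 + X 1 ^ 3 : MvPolynomial (Fin 3) A) = X 0 ^ 3 + 3 * X 1 ^ 2 := by
  simp only [map_add, pderiv_mul, pderiv_pow, pderiv_X_self,
    pderiv_X_of_ne (show (2 : Fin 3) ≠ 1 by decide), pderiv_X_of_ne (show (0 : Fin 3) ≠ 1 by decide),
    mul_zero, zero_add, add_zero, mul_one, one_mul]
  push_cast
  ring

/-- **The renaming automorphism `X₁ ↔ X₂` of `k[X₀, X₁, X₂]` carries `g_y = X₂² + X₁X₀³ + X₁³` to the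
`E₇` form `X₁² + X₂X₀³ + X₂³`** of `E8Char5.e7_fedder_char5` (`MvPolynomial.rename_X`). [folklore] -/
theorem rename_swap_gy {A : Type*} [CommRing A] :
    rename (Equiv.swap (1 : Fin 3) 2) (X 2 ^ 2 + X 1 * X 0 ^ 3 + X 1 ^ 3 : MvPolynomial (Fin 3) A) =
      X 1 ^ 2 + X 2 * X 0 ^ 3 + X 2 ^ 3 := by
  simp only [map_add, map_mul, map_pow, rename_X]
  have h0 : (Equiv.swap (1 : Fin 3) 2) 0 = 0 := by decide
  have h1 : (Equiv.swap (1 : Fin 3) 2) 1 = 2 := by decide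
  have h2 : (Equiv.swap (1 : Fin 3) 2) 2 = 1 := by decide
  rw [h0, h1, h2]

/-- **Fedder's test passes for `g_y` in characteristic `5`**: `g_y⁴ ∉ (X₀⁵, X₁⁵, X₂⁵)` for
`g_y = X₂² + X₁X₀³ + X₁³` over a field of characteristic `5`. The renaming automorphism `X₁ ↔ X₂` maps
the monomial ideal `(Xᵢ⁵)` into itself and `g_y⁴` to `(X₁² + X₂X₀³ + X₂³)⁴`, which is not in `(Xᵢ⁵)` by
`E8Char5.e7_fedder_char5`. [cite: Fedder1983, Prop. 1.7] -/
theorem gy_pow_four_notMem (k : Type) [Field k] [CharP k 5] :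
    (X 2 ^ 2 + X 1 * X 0 ^ 3 + X 1 ^ 3 : MvPolynomial (Fin 3) k) ^ 4 ∉
      Ideal.span (Set.range fun i : Fin 3 => (X i : MvPolynomial (Fin 3) k) ^ 5) := by
  intro h
  have hle : (Ideal.span (Set.range fun i : Fin 3 => (X i : MvPolynomial (Fin 3) k) ^ 5)).map
      (rename (Equiv.swap (1 : Fin 3) 2) : MvPolynomial (Fin 3) k →ₐ[k] MvPolynomial (Fin 3) k) ≤
      Ideal.span (Set.range fun i : Fin 3 => (X i : MvPolynomial (Fin 3) k) ^ 5) := by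
    rw [Ideal.map_le_iff_le_comap, Ideal.span_le]
    rintro _ ⟨i, rfl⟩
    rw [SetLike.mem_coe, Ideal.mem_comap, map_pow, rename_X]
    exact Ideal.subset_span ⟨_, rfl⟩
  have h' := hle (Ideal.mem_map_of_mem _ h)
  rw [map_pow, rename_swap_gy] at h'
  exact E8Char5.e7_fedder_char5 k h'

/-- The form `g_y = X₂² + X₁X₀³ + X₁³` lies in `(X₀, X₁, X₂)` and is non-zero (it takes the value `1` at
`(0, 1, 0)`). [folklore] -/
theorem gy_mem_and_ne_zero (k : Type) [Field k] :
    (X 2 ^ 2 + X 1 * X 0 ^ 3 + X 1 ^ 3 : MvPolynomial (Fin 3) k) ∈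
        Ideal.span (Set.range (X : Fin 3 → MvPolynomial (Fin 3) k)) ∧
      (X 2 ^ 2 + X 1 * X 0 ^ 3 + X 1 ^ 3 : MvPolynomial (Fin 3) k) ≠ 0 := by
  have hX : ∀ i : Fin 3, (X i : MvPolynomial (Fin 3) k) ∈
      Ideal.span (Set.range (X : Fin 3 → MvPolynomial (Fin 3) k)) :=
    fun i => Ideal.subset_span ⟨i, rfl⟩
  refine ⟨?_, ?_⟩
  · exact add_mem (add_mem (Ideal.pow_mem_of_mem _ (hX 2) 2 (by norm_num))
      (Ideal.mul_mem_right _ _ (hX 1))) (Ideal.pow_mem_of_mem _ (hX 1) 3 (by norm_num))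
  · intro h0
    have h1 := congrArg (MvPolynomial.aeval (fun i : Fin 3 => (![0, 1, 0] : Fin 3 → k) i)) h0
    simp [Matrix.cons_val_zero, Matrix.cons_val_one, Matrix.cons_val] at h1

/-- A prime `P` of `k[X₀, X₁, X₂]` containing `X₀, X₁, X₂` is the origin `(X₀, X₁, X₂)`: the latter is a
maximal ideal (`Fedder.isMaximal_span_range_X`) contained in the proper ideal `P`. [folklore] -/
theorem eq_span_range_X_of_mem (k : Type) [Field k] (P : Ideal (MvPolynomial (Fin 3) k)) [P.IsPrime]
    (h0 : (X 0 : MvPolynomial (Fin 3) k) ∈ P) (h1 : (X 1 : MvPolynomial (Fin 3) k) ∈ P)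
    (h2 : (X 2 : MvPolynomial (Fin 3) k) ∈ P) :
    P = Ideal.span (Set.range (X : Fin 3 → MvPolynomial (Fin 3) k)) := by
  refine ((Fedder.isMaximal_span_range_X k 3).eq_of_le (Ideal.IsPrime.ne_top ‹_›) ?_).symm
  rw [Ideal.span_le]
  rintro _ ⟨i, rfl⟩
  fin_cases i
  exacts [h0, h1, h2]

/-! ## The two kinds of points of the `y`-chart on the exceptional divisor -/

/-- **The `E₇` point.** For a field `k` of characteristic `5`, `g_y = X₂² + X₁X₀³ + X₁³`, the origin
`P = (X₀, X₁, X₂)` of `S = k[X₀, X₁, X₂]` and a prime `Q` of `S/(g_y)` with `Q ∩ S = P`, the local ring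
`(S/(g_y))_Q` satisfies the per-stalk clause (inline form, `p = 5`): Fedder's test at the origin
(`Fedder.fedder_criterion_origin` with `gy_pow_four_notMem`) gives it for `S_P/(g_y)`, and it is
transported along `S_P/(g_y) ≅ (S/(g_y))_Q` (`QuotLocalizationIso.stub_quotLocalizationIso`,
`DegreeZeroDescent.inlineClause_of_ringEquiv`). [cite: Fedder1983, Prop. 1.7 and Thm. 1.12] -/
theorem clause_of_comap_eq_origin (k : Type) [Field k] [CharP k 5] (gy : MvPolynomial (Fin 3) k)
    (hgy : gy = X 2 ^ 2 + X 1 * X 0 ^ 3 + X 1 ^ 3)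
    (P : Ideal (MvPolynomial (Fin 3) k)) [P.IsMaximal]
    (hP : P = Ideal.span (Set.range (X : Fin 3 → MvPolynomial (Fin 3) k)))
    (Q : Ideal (MvPolynomial (Fin 3) k ⧸ Ideal.span {gy})) [Q.IsPrime]
    (hQP : Q.comap (Ideal.Quotient.mk (Ideal.span {gy})) = P) :
    ∀ d : ℕ, ringKrullDim (Localization.AtPrime Q) = d → ∀ s : Fin d → Localization.AtPrime Q,
      (Ideal.span (Set.range s)).radical.IsMaximal →
        RingTheory.Sequence.IsWeaklyRegular (Localization.AtPrime Q) (List.ofFn s) ∧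
        ∀ y : Localization.AtPrime Q, (∃ e : ℕ, y ^ 5 ^ e ∈ Ideal.span
          ((fun z : Localization.AtPrime Q => z ^ 5 ^ e) ''
            (Ideal.span (Set.range s) : Set (Localization.AtPrime Q)))) → y ∈ Ideal.span (Set.range s) := by
  haveI : Fact (Nat.Prime 5) := ⟨Nat.prime_five⟩
  obtain ⟨hgP, hg0⟩ : gy ∈ P ∧ gy ≠ 0 := by
    rw [hgy, hP]
    exact gy_mem_and_ne_zero k
  have hL := (Fedder.fedder_criterion_origin 5 k 3 P hP gy hgP hg0).mpr (by
    rw [hgy]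
    exact gy_pow_four_notMem k)
  obtain ⟨e⟩ := QuotLocalizationIso.stub_quotLocalizationIso (MvPolynomial (Fin 3) k) gy P Q hQP
  exact DegreeZeroDescent.inlineClause_of_ringEquiv 5 e hL

/-- **The regular points.** For a field `k` of characteristic `5`, `g_y = X₂² + X₁X₀³ + X₁³` and a maximal
ideal `Q` of `S/(g_y)` with `X̄₁ ∈ Q` but `X₀ ∉ P = Q ∩ S`, the local ring `(S/(g_y))_Q` satisfies the
per-stalk clause (inline form, `p = 5`): `∂g_y/∂X₁ = X₀³ + 3X₁² ∉ P` (else `X₀³ ∈ P`, `X₀ ∈ P`), so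
`(S/(g_y))_Q` is a regular local ring (`HypersurfaceRegular.stub_hypersurfaceRegularOfPderiv`) of
characteristic `5`, and regular local rings satisfy the clause (`FiClauseOfRegular.stub_fiClauseOfRegular`).
[cite: Matsumura1987, Thm. 30.4 (ii)] -/
theorem clause_of_X_zero_notMem (k : Type) [Field k] [CharP k 5] (gy : MvPolynomial (Fin 3) k)
    (hgy : gy = X 2 ^ 2 + X 1 * X 0 ^ 3 + X 1 ^ 3)
    (Q : Ideal (MvPolynomial (Fin 3) k ⧸ Ideal.span {gy})) [Q.IsMaximal]
    (hX1 : Ideal.Quotient.mk (Ideal.span {gy}) (X 1) ∈ Q)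
    (hX0 : (X 0 : MvPolynomial (Fin 3) k) ∉ Q.comap (Ideal.Quotient.mk (Ideal.span {gy}))) :
    ∀ d : ℕ, ringKrullDim (Localization.AtPrime Q) = d → ∀ s : Fin d → Localization.AtPrime Q,
      (Ideal.span (Set.range s)).radical.IsMaximal →
        RingTheory.Sequence.IsWeaklyRegular (Localization.AtPrime Q) (List.ofFn s) ∧
        ∀ y : Localization.AtPrime Q, (∃ e : ℕ, y ^ 5 ^ e ∈ Ideal.span
          ((fun z : Localization.AtPrime Q => z ^ 5 ^ e) ''
            (Ideal.span (Set.range s) : Set (Localization.AtPrime Q)))) → y ∈ Ideal.span (Set.range s) := by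
  haveI : Fact (Nat.Prime 5) := ⟨Nat.prime_five⟩
  -- the Jacobian direction `∂/∂X₁` is regular at `Q`
  have hd : pderiv 1 gy ∉ Q.comap (Ideal.Quotient.mk (Ideal.span {gy})) := by
    intro hmem
    have hpd : pderiv 1 gy = X 0 ^ 3 + 3 * X 1 ^ 2 := by
      rw [hgy]
      exact pderiv_one_gy
    rw [hpd] at hmem
    have hX1' : (X 1 : MvPolynomial (Fin 3) k) ∈ Q.comap (Ideal.Quotient.mk (Ideal.span {gy})) := hX1
    have h3 : (3 * X 1 ^ 2 : MvPolynomial (Fin 3) k) ∈ Q.comap (Ideal.Quotient.mk (Ideal.span {gy})) :=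
      Ideal.mul_mem_left _ _ (Ideal.pow_mem_of_mem _ hX1' 2 (by norm_num))
    have hX03 : (X 0 : MvPolynomial (Fin 3) k) ^ 3 ∈ Q.comap (Ideal.Quotient.mk (Ideal.span {gy})) := by
      have h' := sub_mem hmem h3
      rwa [add_sub_cancel_right] at h'
    exact hX0 (Ideal.IsPrime.mem_of_pow_mem inferInstance 3 hX03)
  haveI : IsRegularLocalRing (Localization.AtPrime Q) :=
    HypersurfaceRegular.stub_hypersurfaceRegularOfPderiv k 3 gy 1 Q hd
  -- characteristic `5` passes to `S/(g_y)` (a non-trivial `k`-algebra) and to its localization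
  haveI : Nontrivial (MvPolynomial (Fin 3) k ⧸ Ideal.span {gy}) :=
    nontrivial_of_ne (1 : MvPolynomial (Fin 3) k ⧸ Ideal.span {gy}) 0 fun h10 =>
      Ideal.IsMaximal.ne_top ‹_› ((Ideal.eq_top_iff_one Q).mpr (by rw [h10]; exact Q.zero_mem))
  haveI : CharP (MvPolynomial (Fin 3) k ⧸ Ideal.span {gy}) 5 :=
    charP_of_injective_algebraMap
      (algebraMap k (MvPolynomial (Fin 3) k ⧸ Ideal.span {gy})).injective 5
  haveI : CharP (Localization.AtPrime Q) 5 := DegreeZeroDescent.charP_localization_atPrime 5 Q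
  exact (FiClauseOfRegular.stub_fiClauseOfRegular 5 (Localization.AtPrime Q)).2

/-! ## Registered form -/

/-- **CALIBRATION, `y`-chart of `Bl_𝔪 E₈⁰` in characteristic 5** (stub `stub_e8ChartYPoints` of line
`Sketch`): for a field `k` of characteristic `5` and `g_y = X₂² + X₁X₀³ + X₁³ ∈ S = k[X₀, X₁, X₂]` (the
strict transform of `z² + x³ + y⁵` on the chart `x = yu, z = yv`), the local ring of the hypersurface
`S/(g_y)` at every maximal ideal `Q` on the exceptional divisor (`X̄₁ ∈ Q`) satisfies the per-stalk
clause of `FrobeniusLadder.FInjectiveMacaulayfication`: every system of parameters is weakly regular and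
generates a Frobenius closed ideal. Two cases on `P = Q ∩ S`: `X₀ ∈ P` forces `P = (X₀, X₁, X₂)`, the
`E₇` point, certified by Fedder's test (`clause_of_comap_eq_origin`); `X₀ ∉ P` is a regular point by the
Jacobian criterion (`clause_of_X_zero_notMem`). [cite: Fedder1983, Prop. 1.7 and Thm. 1.12] -/
theorem stub_e8ChartYPoints : ∀ (k : Type) [Field k] [CharP k 5] (gy : MvPolynomial (Fin 3) k),
    gy = MvPolynomial.X 2 ^ 2 + MvPolynomial.X 1 * MvPolynomial.X 0 ^ 3 + MvPolynomial.X 1 ^ 3 →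
    ∀ (Q : Ideal (MvPolynomial (Fin 3) k ⧸ Ideal.span {gy})) [Q.IsMaximal],
      Ideal.Quotient.mk (Ideal.span {gy}) (MvPolynomial.X 1) ∈ Q →
      ∀ d : ℕ, ringKrullDim (Localization.AtPrime Q) = d → ∀ s : Fin d → Localization.AtPrime Q,
        (Ideal.span (Set.range s)).radical.IsMaximal →
          RingTheory.Sequence.IsWeaklyRegular (Localization.AtPrime Q) (List.ofFn s) ∧
          ∀ y : Localization.AtPrime Q, (∃ e : ℕ, y ^ 5 ^ e ∈ Ideal.span
            ((fun z : Localization.AtPrime Q => z ^ 5 ^ e) ''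
              (Ideal.span (Set.range s) : Set (Localization.AtPrime Q)))) → y ∈ Ideal.span (Set.range s) := by
  intro k _ _ gy hgy Q _ hX1
  by_cases hX0 : (X 0 : MvPolynomial (Fin 3) k) ∈ Q.comap (Ideal.Quotient.mk (Ideal.span {gy}))
  · -- the `E₇` point: `P = Q ∩ S` contains `X₀`, `X₁` and `X₂² = g_y - X₁ (X₀³ + X₁²)`, so it is the origin
    have hX1' : (X 1 : MvPolynomial (Fin 3) k) ∈ Q.comap (Ideal.Quotient.mk (Ideal.span {gy})) := hX1
    have hgP : gy ∈ Q.comap (Ideal.Quotient.mk (Ideal.span {gy})) := by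
      rw [Ideal.mem_comap, Ideal.Quotient.eq_zero_iff_mem.mpr (Ideal.mem_span_singleton_self gy)]
      exact Q.zero_mem
    have hX2sq : (X 2 : MvPolynomial (Fin 3) k) ^ 2 ∈ Q.comap (Ideal.Quotient.mk (Ideal.span {gy})) := by
      have h : (X 2 : MvPolynomial (Fin 3) k) ^ 2 = gy - X 1 * (X 0 ^ 3 + X 1 ^ 2) := by
        rw [hgy]
        ring
      rw [h]
      exact sub_mem hgP (Ideal.mul_mem_right _ _ hX1')
    have hX2 : (X 2 : MvPolynomial (Fin 3) k) ∈ Q.comap (Ideal.Quotient.mk (Ideal.span {gy})) :=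
      Ideal.IsPrime.mem_of_pow_mem inferInstance 2 hX2sq
    have hPeq := eq_span_range_X_of_mem k (Q.comap (Ideal.Quotient.mk (Ideal.span {gy}))) hX0 hX1' hX2
    haveI := Fedder.isMaximal_span_range_X k 3
    exact clause_of_comap_eq_origin k gy hgy (Ideal.span (Set.range X)) rfl Q hPeq
  · -- a regular point of the chart
    exact clause_of_X_zero_notMem k gy hgy Q hX1 hX0

end Summit.ResolutionOfSingularities.ResolutionOfSingularities.Theorems.FInjectiveMacaulayfication.E8ChartYPoints

end
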